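import Literature.Geometry.Kaehler.ComplexTorusRefinedHumbertInvariant
import Literature.Geometry.Kaehler.ComplexTorusAbelianDivisorClassBijection
import HarnessLib

/-!
# Kani's theorem: elliptic curves of degree `d` on a principally polarised abelian surface `(A, θ)` ↔ primitive
# classes `ᾱ ∈ NS(A, θ) = NS(A)/ℤθ` with `q_{(A,θ)}(ᾱ) = d²` (Kani 1994; Auffarth 2015, Thm. 1.2 / 3.9 for `n = 2`)

Layer `Literature/Geometry/Kaehler`, namespace `Literature.Geometry.Kaehler.ComplexTorus`; lane `lit-hodgefound` (Track 2
foundations library, Layer A4 "cycle classes on abelian varieties"), row **A4-62** (seat skel-4), FILE 3 — the junction of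
FILE 1 (`ComplexTorusRefinedHumbertInvariant`: Kani's `q̃_{(A,θ)}(D) = (D·θ)² − 2(D·D)`, positive definite on `NS/ℤθ`)
with row A4-61 FILE 5 (`ComplexTorusAbelianDivisorClassBijection`: Auffarth's Theorem 1.1 / 2.10, abelian divisors ↔
primitive classes `α ∈ NS(X)` with `α² = 0`, `deg α > 0`), at torus level and for surfaces (`n = 2`, abelian divisors =
elliptic curves).

## Source followed, VERBATIM

R. Auffarth, *Elliptic curves on abelian varieties*, Illinois J. Math. **59** (2015), arXiv:1507.08617
[Auffarth2015EllipticCurvesAbelianVarieties] (held `paper:arxiv-1507.08617`; `pNNNN Lk` = chunk/line):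

> **Theorem 1.2** (p0003 L46–L47). Let `(A, Θ)` be a ppav. Then there is a bijective correspondence between abelian
> divisors `Z ⊆ A` with `(Z · Θ^{n−1}) = d` and primitive numerical classes `α ∈ NS(A, Θ)` that satisfy
> `q_r(α) = (−1)^r d^r` for `r = 2, …, n`, given by `Z ↦ [Z]`.
> (p0003 L36–L40) `q_r(α) := −((α^♮)^r · Θ^{n−r}) / ((r−1)(Θ^n))` … "For `n = 2`, we get precisely the quadratic form
> that Kani introduces in his paper [Kani]. We can see these as forms on the polarized Néron–Severi group
> `NS(A, Θ) := NS(A)/ℤ[Θ]`." (p0003 L19) "we will say that `g ∈ G` is a primitive element of `G` if `G/⟨g⟩` is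
> torsion-free."
> **Lemma 3.7** (p0007 L70). Let `(A, Θ)` be a ppav. Then the class of an abelian divisor in `NS(A, Θ)` is primitive.
> *Proof.* Let `Z` be an abelian divisor on `A`, and assume that `Z ≡ mD + sΘ` for some divisor `D` and `m, s ∈ ℤ`.
> We can also assume that […] `(m, s) = 1`, since `Z` is primitive in `NS(A)`. […] Since `[Z]² = 0` […]
> **Lemma 3.8** (p0008 L7). Take `α ∈ NS(A)` and let `d, k ∈ ℤ` be such that `k` is positive, `deg α = d` and
> `q_r(α) = (−1)^r k^r` for `r = 2, …, n`. Then `d − k ≡ 0 (mod n!)`. […] "(the case `n = 2` is trivial)".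
> **Theorem 3.9** (p0008 L27–L47) […] *Proof.* First we will prove injectivity. If `[Z] = [Y]` in `NS(A, Θ)`, then
> `Z ≡ Y + mΘ` for some `m ∈ ℤ`. By squaring […] we get that `m(2 deg Y + m(Θ^n)) = 0`, `m(−2 deg Z + m(Θ^n)) = 0`.
> But this is only possible if `m = 0`, since `deg Z` and `deg Y` are positive. For surjectivity, first let
> `[α] ∈ NS(A, Θ)` be a primitive class such that `q_r(α) = (−1)^r d^r`. By Lemma (15), we get that
> `deg α − d ≡ 0 (mod n!)`, and we define `β := α − ((deg α − d)/n!) [Θ]`. Since `α` is primitive in `NS(A, Θ)`, it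
> is trivial to see that `β` is primitive in `NS(A)`. Moreover, `q_r(β) = q_r(α)` and `deg β = d`. This means that
> `(β^r · Θ^{n−r}) = 0` for all `2 ≤ r ≤ n`, and so by Theorem (8), `β`, and thus `α`, comes from an abelian divisor. □

E. Kani, *Curves of genus 2 on abelian surfaces* [KaniCurvesGenus2AbelianSurfaces], §2 (11) (chunk p0005):
"`q̃_{(A,θ)}(D) = (D.θ)² − 2(D.D)` … defines a positive-definite quadratic form `q_{(A,θ)}` on … `NS(A,θ) := NS(A)/ℤθ`
(see [K1])", [K1] = E. Kani, *Elliptic curves on abelian surfaces*, Manuscripta Math. 84 (1994)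
[Kani1994EllipticCurvesAbelianSurfaces] — where the correspondence of Theorem 1.2 (`n = 2`) is proved (Auffarth, p0003:
"Kani [Kani] described all abelian surfaces that contain an elliptic curve by means of intersection theory, and in this
paper we generalize his methods to arbitrary dimension").

## The rendering (torus level, `n = 2`; dictionary as in FILE 1 and row A4-61)

`X = E/Φ(ℤ^ι)` a complex torus of dimension `2` (`e : Fin (2·1+2) ≃ ι`), `θ = η₀` a PRINCIPAL polarisation
(`IsPrincipalPolarization Φ η₀`: a Riemann form with unimodular lattice form, so `(θ²) = ∫_X θ_ℂ ∧ θ_ℂ = 2`), `NS(X)` = real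
`2`-forms `D` with `IsNSForm Φ D`, classes read in `H²(X, ℂ)` via `D_ℂ = ofRealForm D`; an elliptic curve `Y ⊂ X` is the
subtorus `π(ΦW)` of a complex lattice plane `W` (`IsLatticeSubspace W`, `IsComplexSubspace Φ W`, `rk(Λ ∩ W) = 2`) with its
class `[Y] = (SubtorusFrame.ofSubspace Φ W hW hWc eY hpos).cycleForm e` (p36, row A4-61) and its degree
`deg_θ Y = (Y · θ) = ∫_X c₁(θ) ∧ [Y]`, `c₁(θ) = −θ_ℂ` (the tree's sign, row A4-16), a positive integer. Auffarth's
"`α ∈ NS(A, Θ)` primitive" (`NS(A,Θ)/⟨α⟩` torsion-free; in the free group `NS(A)/ℤΘ` this is indivisibility) is rendered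
for a representative `D ∈ NS(X)` as: **`∀ k s ∈ ℤ, ∀ D′ ∈ NS(X), D = kD′ + sθ ⟹ k = ±1`**.

## Contents (theorems only; no definition, no named fact)

* §0 bilinear bookkeeping for `(D·D′) = Re ∫_X D_ℂ ∧ D′_ℂ` (FILE 1 §0), `NS(X)` is closed under `kD + sD′`.
* §1 **Lemma 3.7 for `n = 2`** (`IsPrincipalPolarization.eq_one_or_eq_neg_one_of_cycleForm_eq_zsmul_add_zsmul`): if
  `[Y] = (kD + sθ)_ℂ` with `D ∈ NS(X)`, then `k = ±1` — the class of an elliptic curve is PRIMITIVE in `NS(X)/ℤθ`. Proof as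
  printed: `(k, s) = 1` because `[Y]` is primitive in `H²(X, ℤ)` (row A4-61 `cycleForm_ofSubspace_mem_primitive_wedge_degree`);
  then `[Y]² = 0` reads `k²(D·D) + 2ks(D·θ) + 2s² = 0`, so `k ∣ 2s²`, `k ∣ 2`, and `k = ±2` would force `s` even.
* §2 **Theorem 3.9 for `n = 2`, injectivity** (`IsPrincipalPolarization.eq_of_cycleForm_eq_add_zsmul`): if
  `[Y′]_NS = [Y]_NS + mθ` then `m = 0` and `Y′ = Y` (`m(2 deg + 2m) = 0` twice, degrees positive; row A4-61
  `eq_of_cycleForm_ofSubspace_eq`).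
* §3 **Theorem 3.9 for `n = 2`, surjectivity** (`IsPrincipalPolarization.exists_ellipticCurve_of_refinedHumbert_eq_sq`): for
  `D ∈ NS(X)` primitive mod `θ` with `q̃_{(A,θ)}(D) = d²`, `d > 0`: `deg D ≡ d (mod 2)` (Lemma 3.8, `n = 2`), and
  `β := D + mθ`, `m = −((D·θ) + d)/2`, has `β² = 0`, `deg β = d`, is primitive in `NS(X)`, hence `β_ℂ = [Y]` for an
  elliptic curve `Y` of degree `d` (row A4-61 FILE 5 `exists_cycleForm_eq_of_primitive_of_wedge_self_eq_zero_of_degree_pos`).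
* §4 **KANI'S THEOREM** (`IsPrincipalPolarization.existsUnique_ellipticCurve_of_refinedHumbert_eq_sq`: EXACTLY ONE
  elliptic curve `Y` with `[Y] ≡ D (mod ℤθ)`; `IsPrincipalPolarization.exists_ellipticCurve_degree_eq_iff`: **`X` contains
  an elliptic curve of degree `d` iff `q_{(A,θ)}` PRIMITIVELY represents `d²`**; and the forward data
  `IsPrincipalPolarization.exists_isNSForm_cycleForm_primitive_refinedHumbert_eq_sq`: `[Y] ∈ NS(X)`, primitive mod `θ`,
  `q̃([Y]) = (deg Y)²`, `deg Y ∈ ℤ_{>0}`).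

## Scope (NOT formalised here)

Auffarth's general `n` (the forms `q_r`, `r ≥ 3`, Lemmas 3.5/3.8 with `n!`), Corollary 3.10 (elliptic subgroups via
abelian complements) and the non-principal Prop. 3.11 are not treated; `NS(A,Θ)` is not formed as a quotient group
(primitivity is stated on representatives, see above).

## References

* [Auffarth2015EllipticCurvesAbelianVarieties] R. Auffarth, *Elliptic curves on abelian varieties*, Illinois J. Math. 59
  (2015) 271–279 — Thm. 1.2, Def. 3.6, Lemma 3.7, Lemma 3.8, Thm. 3.9.
* [Kani1994EllipticCurvesAbelianSurfaces] E. Kani, *Elliptic curves on abelian surfaces*, Manuscripta Math. 84 (1994)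
  199–223.
* [KaniCurvesGenus2AbelianSurfaces] E. Kani, *Curves of genus 2 on abelian surfaces*, preprint, §2 (11), Cor. 11, Lemma 12.
* [Lange2023AbelianVarietiesComplex] H. Lange, *Abelian Varieties over the Complex Numbers* (2023), §2.1.1, §6.2.4.
-/

noncomputable section

set_option maxSynthPendingDepth 3

open Module Function Complex Set

namespace Literature.Geometry.Kaehler

namespace ComplexTorus

open Literature.Analysis.Complex Literature.LinearAlgebra.Alternating

/-! ## §0 Bookkeeping: `(kD + sD′ · D″)`, `NS(X)` under `kD + sD′`, `(zD)_ℂ = z D_ℂ` -/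

section Helpers

variable {ι : Type*} [DecidableEq ι] {E : Type*} [NormedAddCommGroup E] [NormedSpace ℂ E]
  (Φ : (ι → ℝ) ≃L[ℝ] E) (e : Fin (2 * 1 + 2) ≃ ι)

/-- `((aα + bβ) · γ) = a(α·γ) + b(β·γ)`. [cite: Lange2023AbelianVarietiesComplex, §6.2.4 p. 310 (`∫_X` linear)] -/
theorem re_torusIntegral_wedge_add_smul_left (a b : ℝ) (α β γ : E [⋀^Fin 2]→L[ℝ] ℝ) :
    (torusIntegral Φ e ((ofRealForm (a • α + b • β)).wedge (ofRealForm γ))).re =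
      a * (torusIntegral Φ e ((ofRealForm α).wedge (ofRealForm γ))).re +
        b * (torusIntegral Φ e ((ofRealForm β).wedge (ofRealForm γ))).re := by
  rw [re_torusIntegral_wedge_add_left, re_torusIntegral_wedge_smul_left, re_torusIntegral_wedge_smul_left]

/-- `((aα + bβ)²) = a²(α·α) + 2ab(α·β) + b²(β·β)` (Auffarth's "by squaring", proof of Thm. 3.9).
[cite: Auffarth2015EllipticCurvesAbelianVarieties, §3 proof of Thm. 3.9 (p0008 L30–L36)] -/
theorem re_torusIntegral_wedge_add_smul_self (a b : ℝ) (α β : E [⋀^Fin 2]→L[ℝ] ℝ) :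
    (torusIntegral Φ e ((ofRealForm (a • α + b • β)).wedge (ofRealForm (a • α + b • β)))).re =
      a ^ 2 * (torusIntegral Φ e ((ofRealForm α).wedge (ofRealForm α))).re +
        2 * a * b * (torusIntegral Φ e ((ofRealForm α).wedge (ofRealForm β))).re +
        b ^ 2 * (torusIntegral Φ e ((ofRealForm β).wedge (ofRealForm β))).re := by
  rw [re_torusIntegral_wedge_add_smul_left, re_torusIntegral_wedge_add_right, re_torusIntegral_wedge_smul_right,
    re_torusIntegral_wedge_smul_right, re_torusIntegral_wedge_add_right, re_torusIntegral_wedge_smul_right,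
    re_torusIntegral_wedge_smul_right, re_torusIntegral_wedge_comm Φ e β α]
  ring

omit [DecidableEq ι] in
/-- `(zD)_ℂ = z · D_ℂ` for `z ∈ ℤ`. [cite: Lange2023AbelianVarietiesComplex, §1.1.3 Cor. 1.1.19] -/
theorem ofRealForm_zsmul (z : ℤ) (D : E [⋀^Fin 2]→L[ℝ] ℝ) : ofRealForm (z • D) = (z : ℂ) • ofRealForm D := by
  rw [← Int.cast_smul_eq_zsmul ℝ z D, ofRealForm_smul, Complex.ofReal_intCast]

omit [DecidableEq ι] in
/-- `NS(X)` is a group: `kD + sD′ ∈ NS(X)` for `D, D′ ∈ NS(X)`, `k, s ∈ ℤ`. [cite: Lange2023AbelianVarietiesComplex, §1.3.1 (`NS(X)` a group)] -/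
theorem IsNSForm.zsmul_add_zsmul {D D' : E [⋀^Fin 2]→L[ℝ] ℝ} (hD : IsNSForm Φ D) (hD' : IsNSForm Φ D') (k s : ℤ) :
    IsNSForm Φ (k • D + s • D') := by
  rw [← mem_neronSeveriGroup_iff] at hD hD' ⊢
  exact add_mem (AddSubgroup.zsmul_mem _ hD k) (AddSubgroup.zsmul_mem _ hD' s)

end Helpers

/-! ## §1 Lemma 3.7 (`n = 2`): the class of an elliptic curve is primitive in `NS(X)/ℤθ` -/

section Primitive

variable {ι : Type*} [Fintype ι] [DecidableEq ι] {E : Type*} [NormedAddCommGroup E] [NormedSpace ℂ E]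
  (Φ : (ι → ℝ) ≃L[ℝ] E) (W : Submodule ℝ (ι → ℝ)) (hW : IsLatticeSubspace W) (hWc : IsComplexSubspace Φ W)
  (eY : Fin (2 * 1) ≃ Fin (subRank W)) (hpos : orientationSign (subtorusPeriod Φ W hW hWc) eY = 1)
  (e : Fin (2 * 1 + 2) ≃ ι)

/-- **Lemma 3.7 for `n = 2`: the class of an elliptic curve `Y ⊂ X` is PRIMITIVE in `NS(X, θ) = NS(X)/ℤθ`** for a
principal polarisation `θ`: if `[Y] = (kD + sθ)_ℂ` with `D ∈ NS(X)` and `k, s ∈ ℤ`, then `k = ±1`. As printed: `(k, s) = 1`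
since `[Y]` is primitive in `NS(X)` (row A4-61, Lemma 2.7: `cycleForm_ofSubspace_mem_primitive_wedge_degree`), and
`[Y]² = 0` gives `k²(D·D) + 2ks(D·θ) + s²(θ²) = 0` with `(θ²) = 2`; so `k ∣ 2s²`, `k ∣ 2`, and `k = ±2` would make `s`
even. (Auffarth notes after the proof that this FAILS for non-principal `Θ`.)
[cite: Auffarth2015EllipticCurvesAbelianVarieties, §3 Lemma 3.7 and its proof (p0007 L70–L80, p0008 L1)] [cite: KaniCurvesGenus2AbelianSurfaces, §2 Cor. 11 (proof) and Lemma 12 (chunks p0007–p0008)] [cite: Kani1994EllipticCurvesAbelianSurfaces] -/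
theorem IsPrincipalPolarization.eq_one_or_eq_neg_one_of_cycleForm_eq_zsmul_add_zsmul {η₀ : E [⋀^Fin 2]→L[ℝ] ℝ}
    (hp : IsPrincipalPolarization Φ η₀) {η D : E [⋀^Fin 2]→L[ℝ] ℝ}
    (hη : ofRealForm η = (SubtorusFrame.ofSubspace Φ W hW hWc eY hpos).cycleForm e) (hD : IsNSForm Φ D)
    {k s : ℤ} (h : η = k • D + s • η₀) : k = 1 ∨ k = -1 := by
  classical
  obtain ⟨-, hprim, hsq0, hdeg⟩ :=
    cycleForm_ofSubspace_mem_primitive_wedge_degree Φ W hW hWc eY hpos e hp.isRiemannForm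
  -- `(k, s) ≠ (0, 0)`: `[Y] ≠ 0` (its degree is positive)
  have hks : ¬(k = 0 ∧ s = 0) := by
    rintro ⟨rfl, rfl⟩
    rw [zero_smul, zero_smul, add_zero] at h
    rw [← hη, h, ofRealForm_zero, ContinuousAlternatingMap.wedge_zero, torusIntegral_zero, Complex.zero_re] at hdeg
    exact lt_irrefl _ hdeg
  -- `(k, s) = 1`, since `[Y]` is primitive in `H²(X, ℤ)`
  obtain ⟨g, k', s', hg0, hcop', hk', hs'⟩ :=
    Int.exists_gcd_one' (Nat.pos_of_ne_zero fun h0 ↦ hks (Int.gcd_eq_zero_iff.1 h0))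
  have hD' : IsNSForm Φ (k' • D + s' • η₀) := hD.zsmul_add_zsmul Φ hp.isRiemannForm.isNSForm k' s'
  have hηg : η = (g : ℤ) • (k' • D + s' • η₀) := by
    rw [h, hk', hs', smul_add, ← mul_smul, ← mul_smul, mul_comm (g : ℤ) k', mul_comm (g : ℤ) s']
  have hg1 : ((g : ℕ) : ℤ) = 1 ∨ ((g : ℕ) : ℤ) = -1 :=
    hprim (g : ℤ) (ofRealForm (k' • D + s' • η₀)) (ofRealForm_mem_integralForms_two Φ hD')
      (by rw [← ofRealForm_zsmul, ← hηg, hη])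
  have hg : (g : ℤ) = 1 := by omega
  rw [hg, mul_one] at hk' hs'
  subst hk' hs'
  have hcop : IsCoprime k s := Int.isCoprime_iff_gcd_eq_one.2 hcop'
  -- `[Y]² = 0`: `k²(D·D) + 2ks(D·θ) + 2s² = 0`
  obtain ⟨b, hb⟩ := hD.exists_int_re_torusIntegral_wedge Φ e hD
  obtain ⟨c, hc⟩ := hD.exists_int_re_torusIntegral_wedge Φ e hp.isRiemannForm.isNSForm
  have h2 := hp.re_torusIntegral_wedge_self_eq_two Φ e
  have hηη : (torusIntegral Φ e ((ofRealForm η).wedge (ofRealForm η))).re = 0 := by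
    rw [hη, hsq0, torusIntegral_zero, Complex.zero_re]
  have hη' : η = (k : ℝ) • D + (s : ℝ) • η₀ := by rw [h, Int.cast_smul_eq_zsmul, Int.cast_smul_eq_zsmul]
  rw [hη', re_torusIntegral_wedge_add_smul_self, hb, hc, h2] at hηη
  have keyZ : k ^ 2 * b + 2 * k * s * c + 2 * s ^ 2 = 0 := by
    have hR : ((k ^ 2 * b + 2 * k * s * c + 2 * s ^ 2 : ℤ) : ℝ) = 0 := by push_cast; linarith
    exact_mod_cast hR
  -- `k ∣ 2s²`, `(k, s) = 1` ⟹ `k ∣ 2` ⟹ `|k| ∈ {1, 2}`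
  have hdvd : k ∣ 2 * s ^ 2 := ⟨-(k * b + 2 * s * c), by linear_combination keyZ⟩
  have hk2 : k ∣ 2 := (hcop.pow_right (n := 2)).dvd_of_dvd_mul_right hdvd
  have hnat : k.natAbs ∣ 2 := by simpa using Int.natAbs_dvd_natAbs.2 hk2
  rcases (Nat.dvd_prime Nat.prime_two).1 hnat with h1 | h2'
  · omega
  · -- `k = ±2`: then `2s² = -4b ∓ 4sc`, `s` is even, contradicting `(k, s) = 1`
    exfalso
    have hk : k = 2 ∨ k = -2 := by omega
    have h2s2 : (2 : ℤ) ∣ s ^ 2 := by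
      rcases hk with rfl | rfl
      · exact ⟨-(b + s * c), by linarith⟩
      · exact ⟨-(b - s * c), by linarith⟩
    have h2s : (2 : ℤ) ∣ s := Int.prime_two.dvd_of_dvd_pow h2s2
    have h2k : (2 : ℤ) ∣ k := by rcases hk with rfl | rfl <;> norm_num
    have hu := hcop.isUnit_of_dvd' h2k h2s
    rw [Int.isUnit_iff] at hu
    omega

/-- **Every elliptic curve `Y ⊂ X` determines a class `D = [Y]_NS ∈ NS(X)`, PRIMITIVE mod `θ`, with `q̃_{(A,θ)}(D) = (deg_θ Y)²`
and `deg_θ Y` a positive integer** — the map `Z ↦ [Z]` of Theorem 1.2 lands in the printed target (`n = 2`): integral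
Lefschetz `(1,1)` (row A4-23) for `[Y] ∈ NS(X)`, FILE 1 `refinedHumbert_eq_degree_sq_of_eq_cycleForm` (Remark 3.2) for the
value, §1 for primitivity. [cite: Auffarth2015EllipticCurvesAbelianVarieties, Thm. 1.2 (p0003 L46–L47), Remark 3.2, Lemma 3.7] [cite: Kani1994EllipticCurvesAbelianSurfaces] [cite: KaniCurvesGenus2AbelianSurfaces, §2 (11) (chunk p0005)] -/
theorem IsPrincipalPolarization.exists_isNSForm_cycleForm_primitive_refinedHumbert_eq_sq [FiniteDimensional ℂ E]
    {η₀ : E [⋀^Fin 2]→L[ℝ] ℝ} (hp : IsPrincipalPolarization Φ η₀) :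
    ∃ (D : E [⋀^Fin 2]→L[ℝ] ℝ) (d : ℤ), IsNSForm Φ D ∧
      ofRealForm D = (SubtorusFrame.ofSubspace Φ W hW hWc eY hpos).cycleForm e ∧
      (∀ (k s : ℤ) (D' : E [⋀^Fin 2]→L[ℝ] ℝ), IsNSForm Φ D' → D = k • D' + s • η₀ → k = 1 ∨ k = -1) ∧
      0 < d ∧ (torusIntegral Φ e ((wedgePow (ofRealForm (-η₀)) 1).wedge
        ((SubtorusFrame.ofSubspace Φ W hW hWc eY hpos).cycleForm e))).re = d ∧
      refinedHumbert Φ e η₀ D = (d : ℝ) ^ 2 := by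
  obtain ⟨D, hD, hDγ, hq, hdeg⟩ := exists_isNSForm_eq_cycleForm_refinedHumbert_eq Φ W hW hWc eY hpos e hp.isRiemannForm
  -- the degree is the integer `-(D·θ)`
  obtain ⟨a, ha⟩ := hD.exists_int_re_torusIntegral_wedge Φ e hp.isRiemannForm.isNSForm
  have hdeg_eq : (torusIntegral Φ e ((wedgePow (ofRealForm (-η₀)) 1).wedge
      ((SubtorusFrame.ofSubspace Φ W hW hWc eY hpos).cycleForm e))).re = ((-a : ℤ) : ℝ) := by
    rw [← hDγ, wedgePow_one_eq_self, re_torusIntegral_wedge_neg_left, re_torusIntegral_wedge_comm, ha, Int.cast_neg]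
  refine ⟨D, -a, hD, hDγ, fun k s D' hD' h ↦ ?_, ?_, hdeg_eq, by rw [hq, hdeg_eq]⟩
  · exact hp.eq_one_or_eq_neg_one_of_cycleForm_eq_zsmul_add_zsmul Φ W hW hWc eY hpos e hDγ hD' h
  · have h := hdeg
    rw [hdeg_eq] at h
    exact_mod_cast h

end Primitive

/-! ## §2 Theorem 3.9 (`n = 2`), injectivity: `[Y′] ≡ [Y] (mod ℤθ)` forces `Y′ = Y` -/

section Injective

variable {ι : Type*} [Fintype ι] [DecidableEq ι] {E : Type*} [NormedAddCommGroup E] [NormedSpace ℂ E]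
  (Φ : (ι → ℝ) ≃L[ℝ] E) (W : Submodule ℝ (ι → ℝ)) (hW : IsLatticeSubspace W) (hWc : IsComplexSubspace Φ W)
  (eY : Fin (2 * 1) ≃ Fin (subRank W)) (hpos : orientationSign (subtorusPeriod Φ W hW hWc) eY = 1)
  {W' : Submodule ℝ (ι → ℝ)} (hW' : IsLatticeSubspace W') (hWc' : IsComplexSubspace Φ W')
  (eY' : Fin (2 * 1) ≃ Fin (subRank W')) (hpos' : orientationSign (subtorusPeriod Φ W' hW' hWc') eY' = 1)
  (e : Fin (2 * 1 + 2) ≃ ι)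

/-- **Theorem 3.9, injectivity (`n = 2`)**: if the classes of two elliptic curves `Y, Y′ ⊂ X` agree in `NS(X)/ℤθ`,
`[Y′] = [Y] + mθ`, then `m = 0` and `Y′ = Y`. As printed: squaring gives `m(2(Y·θ) + 2m) = 0` and `m(−2(Y′·θ)… ) = 0`
with both degrees positive, so `m = 0`; then `[Y′] = [Y]` and row A4-61 (`eq_of_cycleForm_ofSubspace_eq`, Lemma 2.4 /
Thm. 2.10 injectivity) gives `Y′ = Y`. [cite: Auffarth2015EllipticCurvesAbelianVarieties, §3 Thm. 3.9, proof, injectivity (p0008 L30–L36)] [cite: Kani1994EllipticCurvesAbelianSurfaces] -/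
theorem IsPrincipalPolarization.eq_of_cycleForm_eq_add_zsmul {η₀ : E [⋀^Fin 2]→L[ℝ] ℝ} (hp : IsPrincipalPolarization Φ η₀)
    {η η' : E [⋀^Fin 2]→L[ℝ] ℝ} (hη : ofRealForm η = (SubtorusFrame.ofSubspace Φ W hW hWc eY hpos).cycleForm e)
    (hη' : ofRealForm η' = (SubtorusFrame.ofSubspace Φ W' hW' hWc' eY' hpos').cycleForm e) {m : ℤ}
    (h : η' = η + m • η₀) : m = 0 ∧ W = W' := by
  classical
  obtain ⟨-, -, hsq, hdeg⟩ := cycleForm_ofSubspace_mem_primitive_wedge_degree Φ W hW hWc eY hpos e hp.isRiemannForm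
  obtain ⟨-, -, hsq', hdeg'⟩ :=
    cycleForm_ofSubspace_mem_primitive_wedge_degree Φ W' hW' hWc' eY' hpos' e hp.isRiemannForm
  -- `a = (Y·θ_form) = -deg Y < 0`, `a' = -deg Y' < 0`
  have ha : (torusIntegral Φ e ((ofRealForm η).wedge (ofRealForm η₀))).re < 0 := by
    rw [← hη, wedgePow_one_eq_self, re_torusIntegral_wedge_neg_left, re_torusIntegral_wedge_comm] at hdeg
    linarith
  have ha' : (torusIntegral Φ e ((ofRealForm η').wedge (ofRealForm η₀))).re < 0 := by
    rw [← hη', wedgePow_one_eq_self, re_torusIntegral_wedge_neg_left, re_torusIntegral_wedge_comm] at hdeg'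
    linarith
  have h0 : (torusIntegral Φ e ((ofRealForm η).wedge (ofRealForm η))).re = 0 := by
    rw [hη, hsq, torusIntegral_zero, Complex.zero_re]
  have h0' : (torusIntegral Φ e ((ofRealForm η').wedge (ofRealForm η'))).re = 0 := by
    rw [hη', hsq', torusIntegral_zero, Complex.zero_re]
  have h2 := hp.re_torusIntegral_wedge_self_eq_two Φ e
  -- squaring `η' = η + mθ` and `η = η' - mθ`
  have e1 : η' = (1 : ℝ) • η + (m : ℝ) • η₀ := by rw [h, one_smul, Int.cast_smul_eq_zsmul]
  have e2 : η = (1 : ℝ) • η' + (-(m : ℝ)) • η₀ := by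
    rw [h, one_smul, neg_smul, Int.cast_smul_eq_zsmul]; abel
  have k1 : (1 : ℝ) ^ 2 * (torusIntegral Φ e ((ofRealForm η).wedge (ofRealForm η))).re +
      2 * 1 * (m : ℝ) * (torusIntegral Φ e ((ofRealForm η).wedge (ofRealForm η₀))).re +
      (m : ℝ) ^ 2 * (torusIntegral Φ e ((ofRealForm η₀).wedge (ofRealForm η₀))).re = 0 := by
    rw [← re_torusIntegral_wedge_add_smul_self, ← e1, h0']
  have k2 : (1 : ℝ) ^ 2 * (torusIntegral Φ e ((ofRealForm η').wedge (ofRealForm η'))).re +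
      2 * 1 * (-(m : ℝ)) * (torusIntegral Φ e ((ofRealForm η').wedge (ofRealForm η₀))).re +
      (-(m : ℝ)) ^ 2 * (torusIntegral Φ e ((ofRealForm η₀).wedge (ofRealForm η₀))).re = 0 := by
    rw [← re_torusIntegral_wedge_add_smul_self, ← e2, h0]
  rw [h0, h2] at k1
  rw [h0', h2] at k2
  have hsum : (m : ℝ) * ((torusIntegral Φ e ((ofRealForm η).wedge (ofRealForm η₀))).re +
      (torusIntegral Φ e ((ofRealForm η').wedge (ofRealForm η₀))).re) = 0 := by
    linear_combination (k1 - k2) / 2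
  have hm0 : (m : ℝ) = 0 := by
    rcases mul_eq_zero.1 hsum with hm | hs
    · exact hm
    · exfalso; linarith
  have hmZ : m = 0 := by exact_mod_cast hm0
  subst hmZ
  rw [zero_smul, add_zero] at h
  subst h
  exact ⟨rfl, eq_of_cycleForm_ofSubspace_eq Φ W hW hWc eY hpos e hW' hWc' eY' hpos' (hη.symm.trans hη')⟩

end Injective

/-! ## §3 Theorem 3.9 (`n = 2`), surjectivity: a primitive class with `q̃ = d²` comes from an elliptic curve of degree `d` -/

section Surjective

variable {ι : Type*} [Fintype ι] [DecidableEq ι] {E : Type*} [NormedAddCommGroup E] [NormedSpace ℂ E]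
  (Φ : (ι → ℝ) ≃L[ℝ] E) [FiniteDimensional ℂ E] (e : Fin (2 * 1 + 2) ≃ ι)

/-- **Lemma 3.8 for `n = 2` ("trivial"): `deg α ≡ d (mod 2)`** whenever `q̃(α) = (α·θ)² − 2(α·α) = d²` with
`(α·θ), (α·α) ∈ ℤ`: `(α·θ)² ≡ d² (mod 2)`. [cite: Auffarth2015EllipticCurvesAbelianVarieties, §3 Lemma 3.8 ("the case `n = 2` is trivial", p0008 L7–L16)] -/
theorem emod_two_eq_of_sq_sub_two_mul_eq_sq {a b d : ℤ} (h : a ^ 2 - 2 * b = d ^ 2) : a % 2 = d % 2 := by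
  have hsa : a ^ 2 % 2 = a % 2 := by
    rcases Int.emod_two_eq_zero_or_one a with h0 | h0 <;> simp [pow_two, Int.mul_emod, h0]
  have hsd : d ^ 2 % 2 = d % 2 := by
    rcases Int.emod_two_eq_zero_or_one d with h0 | h0 <;> simp [pow_two, Int.mul_emod, h0]
  omega

/-- **Theorem 3.9, surjectivity (`n = 2`): a class `D ∈ NS(X)`, PRIMITIVE in `NS(X)/ℤθ`, with `q̃_{(A,θ)}(D) = d²`
(`d > 0`) is, up to `ℤθ`, the class of an elliptic curve of degree `d`.** As printed: with `a = −deg D = (D·θ-form)`,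
`a ≡ d (mod 2)` (Lemma 3.8), `β := D + mθ` for `m = −(a + d)/2` has `deg β = d` and `β² = (D·D) + 2ma + 2m² = 0`
(using `a² − 2(D·D) = d²`); `β` is primitive in `NS(X)` because `D` is primitive mod `θ`; hence `β_ℂ = [Y]` for an
abelian divisor = elliptic curve `Y` by Theorem 2.10 (row A4-61 FILE 5
`exists_cycleForm_eq_of_primitive_of_wedge_self_eq_zero_of_degree_pos`), and `deg Y = deg β = d`.
[cite: Auffarth2015EllipticCurvesAbelianVarieties, §3 Thm. 3.9, proof, surjectivity (p0008 L38–L47) and Thm. 2.10] [cite: Kani1994EllipticCurvesAbelianSurfaces] [cite: KaniCurvesGenus2AbelianSurfaces, §2 (11) (chunk p0005)] -/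
theorem IsPrincipalPolarization.exists_ellipticCurve_of_refinedHumbert_eq_sq {η₀ : E [⋀^Fin 2]→L[ℝ] ℝ}
    (hp : IsPrincipalPolarization Φ η₀) {D : E [⋀^Fin 2]→L[ℝ] ℝ} (hD : IsNSForm Φ D)
    (hind : ∀ (k s : ℤ) (D' : E [⋀^Fin 2]→L[ℝ] ℝ), IsNSForm Φ D' → D = k • D' + s • η₀ → k = 1 ∨ k = -1)
    {d : ℤ} (hd : 0 < d) (hq : refinedHumbert Φ e η₀ D = (d : ℝ) ^ 2) :
    ∃ (m : ℤ) (W : Submodule ℝ (ι → ℝ)) (hW : IsLatticeSubspace W) (hWc : IsComplexSubspace Φ W)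
      (eY : Fin (2 * 1) ≃ Fin (subRank W)) (hpos : orientationSign (subtorusPeriod Φ W hW hWc) eY = 1),
      ofRealForm (D + m • η₀) = (SubtorusFrame.ofSubspace Φ W hW hWc eY hpos).cycleForm e ∧
        (torusIntegral Φ e ((wedgePow (ofRealForm (-η₀)) 1).wedge
          ((SubtorusFrame.ofSubspace Φ W hW hWc eY hpos).cycleForm e))).re = d := by
  classical
  obtain ⟨a, ha⟩ := hD.exists_int_re_torusIntegral_wedge Φ e hp.isRiemannForm.isNSForm
  obtain ⟨b, hb⟩ := hD.exists_int_re_torusIntegral_wedge Φ e hD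
  have h2 := hp.re_torusIntegral_wedge_self_eq_two Φ e
  -- Kani's equation `a² − 2b = d²` and Lemma 3.8: `a ≡ d (mod 2)`
  have hqR : (a : ℝ) ^ 2 - 2 * b = (d : ℝ) ^ 2 := by rw [← hq, refinedHumbert_eq, ha, hb]
  have hqz : a ^ 2 - 2 * b = d ^ 2 := by exact_mod_cast hqR
  have hpar := emod_two_eq_of_sq_sub_two_mul_eq_sq hqz
  obtain ⟨m, hm2⟩ : ∃ m : ℤ, a + 2 * m = -d := ⟨-((a + d) / 2), by omega⟩
  have hm2R : (a : ℝ) + 2 * m = -d := by exact_mod_cast hm2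
  -- `β := D + mθ`
  set β : E [⋀^Fin 2]→L[ℝ] ℝ := D + m • η₀ with hβ
  clear_value β
  have hβNS : IsNSForm Φ β := by
    have h := hD.zsmul_add_zsmul Φ hp.isRiemannForm.isNSForm 1 m
    rwa [one_zsmul, ← hβ] at h
  have hβ' : β = (1 : ℝ) • D + (m : ℝ) • η₀ := by rw [hβ, one_smul, Int.cast_smul_eq_zsmul]
  -- `(β·θ-form) = a + 2m = -d`, `β² = 0`
  have hβη₀ : (torusIntegral Φ e ((ofRealForm β).wedge (ofRealForm η₀))).re = -d := by
    rw [hβ', re_torusIntegral_wedge_add_smul_left, ha, h2]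
    linarith
  have hββ : (torusIntegral Φ e ((ofRealForm β).wedge (ofRealForm β))).re = 0 := by
    rw [hβ', re_torusIntegral_wedge_add_smul_self, hb, ha, h2]
    linear_combination (-(1 : ℝ) / 2) * hqR + ((a : ℝ) / 2 + m - d / 2) * hm2R
  -- `γ := β_ℂ`: an integral Hodge class with `γ ∧ γ = 0` and `deg γ = d > 0`
  have hγ : ofRealForm β ∈ integralHodgeClasses Φ 1 :=
    (mem_integralHodgeClasses_one_iff_exists Φ).2 ⟨β, (mem_neronSeveriGroup_iff Φ).2 hβNS, rfl⟩
  have hγγ : (ofRealForm β).wedge (ofRealForm β) = 0 := by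
    rw [eq_torusIntegral_smul_volumeForm Φ e ((ofRealForm β).wedge (ofRealForm β)),
      torusIntegral_wedge_ofRealForm_eq_re, hββ, Complex.ofReal_zero, zero_smul]
  have hdeg' : (torusIntegral Φ e ((wedgePow (ofRealForm (-η₀)) 1).wedge (ofRealForm β))).re = d := by
    rw [wedgePow_one_eq_self, re_torusIntegral_wedge_neg_left, re_torusIntegral_wedge_comm, hβη₀, neg_neg]
  have hdeg : 0 < (torusIntegral Φ e ((wedgePow (ofRealForm (-η₀)) 1).wedge (ofRealForm β))).re := by
    rw [hdeg']; exact_mod_cast hd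
  -- `γ` is primitive in `H²(X, ℤ)`, because `D` is primitive mod `θ`
  have hprim : ∀ (k : ℤ) (β' : E [⋀^Fin 2]→L[ℝ] ℂ), β' ∈ integralForms Φ 2 →
      (k : ℂ) • β' = ofRealForm β → k = 1 ∨ k = -1 := by
    intro k β' hβ'I hk
    have hk0 : k ≠ 0 := by
      rintro rfl
      rw [Int.cast_zero, zero_smul] at hk
      have hβ0 : β = 0 := ofRealForm_injective (by rw [← hk, ofRealForm_zero])
      rw [hβ0, ofRealForm_zero, ContinuousAlternatingMap.wedge_zero, torusIntegral_zero, Complex.zero_re] at hdeg'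
      have hd0 : d = 0 := by exact_mod_cast hdeg'.symm
      omega
    have hβ'eq : β' = (k : ℂ)⁻¹ • ofRealForm β := by
      rw [← hk, smul_smul, inv_mul_cancel₀ (Int.cast_ne_zero.2 hk0), one_smul]
    have hβ'H : β' ∈ integralHodgeClasses Φ 1 :=
      (mem_integralHodgeClasses_iff Φ).2
        ⟨hβ'I, by rw [hβ'eq]; exact (((mem_integralHodgeClasses_iff Φ).1 hγ).2).smul _⟩
    obtain ⟨B', hB'NS, hB'⟩ := (mem_integralHodgeClasses_one_iff_exists Φ).1 hβ'H
    have hkB : k • B' = D + m • η₀ := by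
      apply ofRealForm_injective
      rw [ofRealForm_zsmul, hB', hk, hβ]
    exact hind k (-m) B' ((mem_neronSeveriGroup_iff Φ).1 hB'NS) (by rw [hkB, neg_smul]; abel)
  obtain ⟨W, hW, hWc, eY, hpos', -, hγeq⟩ :=
    exists_cycleForm_eq_of_primitive_of_wedge_self_eq_zero_of_degree_pos Φ e hp.isRiemannForm hγ hprim hγγ hdeg
  refine ⟨m, W, hW, hWc, eY, hpos', ?_, ?_⟩
  · rw [← hβ]; exact hγeq
  · rw [← hγeq]; exact hdeg'

/-! ## §4 Kani's theorem: the bijection, and "an elliptic curve of degree `d` iff `q_{(A,θ)}` primitively represents `d²`" -/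

/-- **THEOREM 1.2 / 3.9 FOR `n = 2` (KANI 1994) AS A BIJECTION ONTO ITS IMAGE**: a class `D ∈ NS(X)`, primitive in
`NS(X)/ℤθ`, with `q̃_{(A,θ)}(D) = d²`, `d > 0`, is the class mod `ℤθ` of EXACTLY ONE elliptic curve `Y ⊂ X`
(`[Y] = (D + mθ)_ℂ` for some `m ∈ ℤ`); together with §1 (every `[Y]` is such a class, of `q̃`-value `(deg Y)²`) this is the
printed bijective correspondence `Z ↦ [Z]`. [cite: Auffarth2015EllipticCurvesAbelianVarieties, Thm. 1.2 (p0003 L46–L47) and §3 Thm. 3.9 (p0008 L27–L47)] [cite: Kani1994EllipticCurvesAbelianSurfaces] [cite: KaniCurvesGenus2AbelianSurfaces, §2 (11) (chunk p0005)] -/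
theorem IsPrincipalPolarization.existsUnique_ellipticCurve_of_refinedHumbert_eq_sq {η₀ : E [⋀^Fin 2]→L[ℝ] ℝ}
    (hp : IsPrincipalPolarization Φ η₀) {D : E [⋀^Fin 2]→L[ℝ] ℝ} (hD : IsNSForm Φ D)
    (hind : ∀ (k s : ℤ) (D' : E [⋀^Fin 2]→L[ℝ] ℝ), IsNSForm Φ D' → D = k • D' + s • η₀ → k = 1 ∨ k = -1)
    {d : ℤ} (hd : 0 < d) (hq : refinedHumbert Φ e η₀ D = (d : ℝ) ^ 2) :
    ∃! W : Submodule ℝ (ι → ℝ), ∃ (hW : IsLatticeSubspace W) (hWc : IsComplexSubspace Φ W)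
      (eY : Fin (2 * 1) ≃ Fin (subRank W)) (hpos : orientationSign (subtorusPeriod Φ W hW hWc) eY = 1) (m : ℤ),
      ofRealForm (D + m • η₀) = (SubtorusFrame.ofSubspace Φ W hW hWc eY hpos).cycleForm e := by
  obtain ⟨m, W, hW, hWc, eY, hpos, hγ, -⟩ := hp.exists_ellipticCurve_of_refinedHumbert_eq_sq Φ e hD hind hd hq
  refine ⟨W, ⟨hW, hWc, eY, hpos, m, hγ⟩, ?_⟩
  rintro W' ⟨hW', hWc', eY', hpos', m', hγ'⟩
  have h : D + m' • η₀ = (D + m • η₀) + (m' - m) • η₀ := by rw [sub_smul]; abel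
  exact ((hp.eq_of_cycleForm_eq_add_zsmul Φ W hW hWc eY hpos hW' hWc' eY' hpos' e hγ hγ' h).2).symm

/-- **KANI'S THEOREM (existence form): `X` contains an elliptic curve `Y` of degree `(Y·θ) = d` iff the refined Humbert
form `q_{(A,θ)}` PRIMITIVELY represents `d²`**, i.e. iff `q̃_{(A,θ)}(D) = d²` for some `D ∈ NS(X)` primitive in
`NS(X)/ℤθ` (`d > 0`; ⟹: §1, ⟸: §3). This is the `n = 2` case of Theorem 1.2 read on existence, the torus-level form of
"`(A, θ) ∈ H_{d²}` (Kani's `q_{(A,θ)} → d²`) iff `A` contains an elliptic curve of degree `d`".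
[cite: Kani1994EllipticCurvesAbelianSurfaces] [cite: Auffarth2015EllipticCurvesAbelianVarieties, Thm. 1.2 (p0003 L46–L47), Thm. 3.9] [cite: KaniCurvesGenus2AbelianSurfaces, §2 (11) (chunk p0005)] -/
theorem IsPrincipalPolarization.exists_ellipticCurve_degree_eq_iff {η₀ : E [⋀^Fin 2]→L[ℝ] ℝ}
    (hp : IsPrincipalPolarization Φ η₀) {d : ℤ} (hd : 0 < d) :
    (∃ (W : Submodule ℝ (ι → ℝ)) (hW : IsLatticeSubspace W) (hWc : IsComplexSubspace Φ W)
        (eY : Fin (2 * 1) ≃ Fin (subRank W)) (hpos : orientationSign (subtorusPeriod Φ W hW hWc) eY = 1),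
        (torusIntegral Φ e ((wedgePow (ofRealForm (-η₀)) 1).wedge
          ((SubtorusFrame.ofSubspace Φ W hW hWc eY hpos).cycleForm e))).re = d) ↔
      ∃ D : E [⋀^Fin 2]→L[ℝ] ℝ, IsNSForm Φ D ∧
        (∀ (k s : ℤ) (D' : E [⋀^Fin 2]→L[ℝ] ℝ), IsNSForm Φ D' → D = k • D' + s • η₀ → k = 1 ∨ k = -1) ∧
        refinedHumbert Φ e η₀ D = (d : ℝ) ^ 2 := by
  constructor
  · rintro ⟨W, hW, hWc, eY, hpos, hdeg⟩
    obtain ⟨D, d', hD, -, hind, -, hdeg', hq⟩ :=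
      hp.exists_isNSForm_cycleForm_primitive_refinedHumbert_eq_sq Φ W hW hWc eY hpos e
    have hdd : d' = d := by
      have h : ((d' : ℤ) : ℝ) = d := by rw [← hdeg', hdeg]
      exact_mod_cast h
    subst hdd
    exact ⟨D, hD, hind, hq⟩
  · rintro ⟨D, hD, hind, hq⟩
    obtain ⟨-, W, hW, hWc, eY, hpos, -, hdeg⟩ := hp.exists_ellipticCurve_of_refinedHumbert_eq_sq Φ e hD hind hd hq
    exact ⟨W, hW, hWc, eY, hpos, hdeg⟩

end Surjective

end ComplexTorus

end Literature.Geometry.Kaehler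

end
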